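import Summits.Ventures.HodgeRepro2.T5SU11JacobiWeightDeriv
import Summits.Ventures.HodgeRepro2.T5SU11JacobiJointLogConvex

/-!
# The second derivative of the Jacobi transform in the weight: the second moment of the phase, and
`(log m̂_k(λ))'' = Var_{k,λ}(log|a|) ≥ 0`

Differentiating the first-moment integral of `T5SU11JacobiWeightDeriv` once more under the integral
sign (dominating function `(eε/2)⁻² m_{k−2ε} φ_λ` from `s² e^{−εs} = (s e^{−εs/2})² ≤ (eε/2)⁻²`):

  **`(d²/dk²) m̂_k(λ) = ∫_G (log|a(g)|)² (1 − |g·0|²)^{k/2} φ_λ(g) dν ≥ 0`**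

(`hasDerivAt_first_moment`, `hasDerivAt_deriv_jacobi_weight`, `deriv2_jacobi_weight`,
`deriv2_jacobi_weight_nonneg`), and for the logarithm

  **`(d²/dk²) log m̂_k(λ) = ⟨(log|a|)²⟩_{k,λ} − ⟨log|a|⟩_{k,λ}² = Var_{k,λ}(log|a|) ≥ 0`**

(`deriv2_log_jacobi_weight`, `deriv2_log_jacobi_weight_nonneg`; the variance inequality
`(∫ s m φ)² ≤ (∫ s² m φ)(∫ m φ)` is Cauchy–Schwarz, here Hölder with `a = b = 1/2` from
`T5SU11JacobiJointLogConvex`) — the third derivation of the log-convexity in the weight, in its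
differential form. Nothing is claimed about (N).

Blind lane: Mathlib + the HodgeRepro2 prefix only; no sorry; axioms ⊆ {propext, Classical.choice,
Quot.sound}.
-/

namespace Summit.Ventures.HodgeRepro2.T5SU11JacobiWeightDeriv2

open MeasureTheory MeasureTheory.Measure Metric Set Filter Topology
open T5SU11Unimodular T5SU11Fibration T5SU11Cartan T5HaarCircle T5BergmanCoefficient
  T5SU11FibrationHaar T5SU11SphericalFunction T5SU11SphericalSymmetry T5SU11SphericalBounds
  T5SU11SphericalContinuous T5SU11JacobiIwasawa T5SU11JacobiTransform T5SU11KFiniteMajorantPow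
  T5SU11JacobiWeight T5SU11JacobiWeightDeriv T5SU11JacobiJointLogConvex
open scoped Real

/-- `s² e^{−εs} ≤ (eε/2)⁻²` for `s ≥ 0`, `ε > 0`. -/
theorem sq_mul_exp_neg_le {s ε : ℝ} (hs : 0 ≤ s) (hε : 0 < ε) :
    s ^ 2 * Real.exp (-(ε * s)) ≤ ((Real.exp 1 * (ε / 2))⁻¹) ^ 2 := by
  have h := mul_exp_neg_le (s := s) (ε := ε / 2) (by linarith)
  have h0 : 0 ≤ s * Real.exp (-(ε / 2 * s)) := mul_nonneg hs (Real.exp_pos _).le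
  have e : s ^ 2 * Real.exp (-(ε * s)) = (s * Real.exp (-(ε / 2 * s))) ^ 2 := by
    rw [mul_pow, ← Real.exp_nat_mul]
    congr 2
    push_cast
    ring
  rw [e]
  exact pow_le_pow_left₀ h0 h 2

section measure

variable [MeasurableSpace Circle] [BorelSpace Circle]

omit [BorelSpace Circle] in
/-- The derivative of the first-moment integrand: `(d/dk) s · m_k φ = −s² · m_k φ`. -/
theorem hasDerivAt_log_mul_orbit_rpow_mul_sph (lam : ℝ) (g : SU11) (k : ℝ) :
    HasDerivAt (fun k : ℝ => Real.log ‖mat g 0 0‖ * ((1 - ‖orbit g‖ ^ 2) ^ (k / 2) * sph lam g))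
      (-(Real.log ‖mat g 0 0‖ ^ 2 * ((1 - ‖orbit g‖ ^ 2) ^ (k / 2) * sph lam g))) k := by
  have h := (hasDerivAt_orbit_rpow_mul_sph lam g k).const_mul (Real.log ‖mat g 0 0‖)
  refine h.congr_deriv ?_
  ring

/-- **The first moment is differentiable in the weight, with derivative minus the second moment**:
`(d/dk) ∫_G s m_k φ_λ dν = −∫_G s² m_k φ_λ dν`, the second-moment integrand being integrable. -/
theorem integrable_and_hasDerivAt_first_moment {k lam : ℝ} (hk : 1 < k) (h1 : lam < k)
    (h2 : 2 < k + lam) :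
    Integrable (fun g => -(Real.log ‖mat g 0 0‖ ^ 2 * ((1 - ‖orbit g‖ ^ 2) ^ (k / 2) * sph lam g)))
        (nu haarCircle) ∧
      HasDerivAt (fun k => ∫ g, Real.log ‖mat g 0 0‖ * ((1 - ‖orbit g‖ ^ 2) ^ (k / 2) * sph lam g)
          ∂(nu haarCircle))
        (∫ g, -(Real.log ‖mat g 0 0‖ ^ 2 * ((1 - ‖orbit g‖ ^ 2) ^ (k / 2) * sph lam g))
          ∂(nu haarCircle)) k := by
  set K₀ : ℝ := max 1 (max lam (2 - lam)) with hK₀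
  have hK : K₀ < k := by
    rw [hK₀, max_lt_iff, max_lt_iff]
    exact ⟨hk, h1, by linarith⟩
  have hK1 : 1 ≤ K₀ := le_max_left _ _
  have hK2 : lam ≤ K₀ := (le_max_left _ _).trans (le_max_right _ _)
  have hK3 : 2 - lam ≤ K₀ := (le_max_right _ _).trans (le_max_right _ _)
  set ε : ℝ := (k - K₀) / 4 with hε
  have hε0 : 0 < ε := by
    rw [hε]
    linarith
  have hk' : 1 < k - 2 * ε := by rw [hε]; linarith
  have h1' : lam < k - 2 * ε := by rw [hε]; linarith
  have h2' : 2 < k - 2 * ε + lam := by rw [hε]; linarith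
  have hbound := (integrable_orbit_rpow_mul_sph hk' h1' h2').const_mul
    (((Real.exp 1 * (ε / 2))⁻¹) ^ 2)
  have hcont : ∀ x : ℝ, Continuous fun g : SU11 =>
      Real.log ‖mat g 0 0‖ * ((1 - ‖orbit g‖ ^ 2) ^ (x / 2) * sph lam g) := fun x =>
    continuous_log_norm_mat.mul ((continuous_orbit_rpow x).mul (continuous_sph lam))
  refine hasDerivAt_integral_of_dominated_loc_of_deriv_le (ball_mem_nhds k hε0)
    (Filter.Eventually.of_forall fun x => (hcont x).aestronglyMeasurable)
    (integrable_log_norm_mat_mul_orbit_rpow_mul_sph hk h1 h2)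
    (F' := fun k g => -(Real.log ‖mat g 0 0‖ ^ 2 * ((1 - ‖orbit g‖ ^ 2) ^ (k / 2) * sph lam g))) ?_
    (Filter.Eventually.of_forall fun g x hx => ?_) hbound
    (Filter.Eventually.of_forall fun g x _ => hasDerivAt_log_mul_orbit_rpow_mul_sph lam g x)
  · exact ((continuous_log_norm_mat.pow 2).mul
      ((continuous_orbit_rpow k).mul (continuous_sph lam))).neg.aestronglyMeasurable
  · have hs0 : 0 ≤ Real.log ‖mat g 0 0‖ := log_norm_mat_nonneg g
    have hφ : 0 < sph lam g := sph_pos lam g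
    have hxk : k - ε ≤ x := by
      rw [mem_ball, Real.dist_eq, abs_lt] at hx
      linarith [hx.1]
    show ‖-(Real.log ‖mat g 0 0‖ ^ 2 * ((1 - ‖orbit g‖ ^ 2) ^ (x / 2) * sph lam g))‖
      ≤ ((Real.exp 1 * (ε / 2))⁻¹) ^ 2 * ((1 - ‖orbit g‖ ^ 2) ^ ((k - 2 * ε) / 2) * sph lam g)
    rw [norm_neg, norm_mul, Real.norm_of_nonneg (pow_nonneg hs0 2),
      Real.norm_of_nonneg (mul_nonneg (orbit_rpow_nonneg x g) hφ.le)]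
    have hm : (1 - ‖orbit g‖ ^ 2) ^ (x / 2) ≤ (1 - ‖orbit g‖ ^ 2) ^ ((k - ε) / 2) :=
      orbit_rpow_antitone hxk g
    have hsplit : (1 - ‖orbit g‖ ^ 2) ^ ((k - ε) / 2)
        = Real.exp (-(ε * Real.log ‖mat g 0 0‖)) * (1 - ‖orbit g‖ ^ 2) ^ ((k - 2 * ε) / 2) := by
      rw [orbit_rpow_eq_exp, orbit_rpow_eq_exp, ← Real.exp_add]
      congr 1
      ring
    calc Real.log ‖mat g 0 0‖ ^ 2 * ((1 - ‖orbit g‖ ^ 2) ^ (x / 2) * sph lam g)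
        ≤ Real.log ‖mat g 0 0‖ ^ 2 * ((1 - ‖orbit g‖ ^ 2) ^ ((k - ε) / 2) * sph lam g) := by gcongr
      _ = (Real.log ‖mat g 0 0‖ ^ 2 * Real.exp (-(ε * Real.log ‖mat g 0 0‖)))
            * ((1 - ‖orbit g‖ ^ 2) ^ ((k - 2 * ε) / 2) * sph lam g) := by
          rw [hsplit]
          ring
      _ ≤ ((Real.exp 1 * (ε / 2))⁻¹) ^ 2 * ((1 - ‖orbit g‖ ^ 2) ^ ((k - 2 * ε) / 2) * sph lam g) :=
          mul_le_mul_of_nonneg_right (sq_mul_exp_neg_le hs0 hε0)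
            (mul_nonneg (orbit_rpow_nonneg _ g) hφ.le)

/-- The second-moment integrand `(log|a(g)|)² m_k φ_λ` is integrable on the domain. -/
theorem integrable_sq_log_norm_mat_mul_orbit_rpow_mul_sph {k lam : ℝ} (hk : 1 < k) (h1 : lam < k)
    (h2 : 2 < k + lam) :
    Integrable (fun g => Real.log ‖mat g 0 0‖ ^ 2 * ((1 - ‖orbit g‖ ^ 2) ^ (k / 2) * sph lam g))
      (nu haarCircle) := by
  have h := (integrable_and_hasDerivAt_first_moment hk h1 h2).1.neg
  refine h.congr (Filter.Eventually.of_forall fun g => ?_)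
  simp only [Pi.neg_apply, neg_neg]

/-- **`(d/dk) ∫_G s m_k φ_λ dν = −∫_G s² m_k φ_λ dν`.** -/
theorem hasDerivAt_first_moment {k lam : ℝ} (hk : 1 < k) (h1 : lam < k) (h2 : 2 < k + lam) :
    HasDerivAt (fun k => ∫ g, Real.log ‖mat g 0 0‖ * ((1 - ‖orbit g‖ ^ 2) ^ (k / 2) * sph lam g)
        ∂(nu haarCircle))
      (-∫ g, Real.log ‖mat g 0 0‖ ^ 2 * ((1 - ‖orbit g‖ ^ 2) ^ (k / 2) * sph lam g) ∂(nu haarCircle))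
      k := by
  have h := (integrable_and_hasDerivAt_first_moment hk h1 h2).2
  refine h.congr_deriv ?_
  rw [← integral_neg]

/-- **`(d/dk) (d/dk) m̂_k(λ) = ∫_G (log|a(g)|)² m_k φ_λ dν`**: the derivative of the transform is again
differentiable, with the second moment of the phase as derivative. -/
theorem hasDerivAt_deriv_jacobi_weight {k lam : ℝ} (hk : 1 < k) (h1 : lam < k) (h2 : 2 < k + lam) :
    HasDerivAt (deriv fun k => ∫ g, (1 - ‖orbit g‖ ^ 2) ^ (k / 2) * sph lam g ∂(nu haarCircle))
      (∫ g, Real.log ‖mat g 0 0‖ ^ 2 * ((1 - ‖orbit g‖ ^ 2) ^ (k / 2) * sph lam g) ∂(nu haarCircle))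
      k := by
  have h := (hasDerivAt_first_moment hk h1 h2).neg
  rw [neg_neg] at h
  refine h.congr_of_eventuallyEq ?_
  filter_upwards [Ioi_mem_nhds (show max 1 (max lam (2 - lam)) < k by
    rw [max_lt_iff, max_lt_iff]; exact ⟨hk, h1, by linarith⟩)] with k' hk'
  rw [mem_Ioi, max_lt_iff, max_lt_iff] at hk'
  exact deriv_jacobi_weight hk'.1 hk'.2.1 (by linarith [hk'.2.2])

/-- **The second derivative of the transform in the weight is the second moment of the phase.** -/
theorem deriv2_jacobi_weight {k lam : ℝ} (hk : 1 < k) (h1 : lam < k) (h2 : 2 < k + lam) :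
    deriv (deriv fun k => ∫ g, (1 - ‖orbit g‖ ^ 2) ^ (k / 2) * sph lam g ∂(nu haarCircle)) k
      = ∫ g, Real.log ‖mat g 0 0‖ ^ 2 * ((1 - ‖orbit g‖ ^ 2) ^ (k / 2) * sph lam g) ∂(nu haarCircle) :=
  (hasDerivAt_deriv_jacobi_weight hk h1 h2).deriv

/-- The second derivative is non-negative: `m̂_k(λ)` is convex in the weight (differential form). -/
theorem deriv2_jacobi_weight_nonneg {k lam : ℝ} (hk : 1 < k) (h1 : lam < k) (h2 : 2 < k + lam) :
    0 ≤ deriv (deriv fun k => ∫ g, (1 - ‖orbit g‖ ^ 2) ^ (k / 2) * sph lam g ∂(nu haarCircle)) k := by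
  rw [deriv2_jacobi_weight hk h1 h2]
  exact integral_nonneg fun g =>
    mul_nonneg (sq_nonneg _) (mul_nonneg (orbit_rpow_nonneg k g) (sph_pos lam g).le)

/-! ### The variance -/

/-- **Cauchy–Schwarz for the phase**: `(∫_G s m_k φ_λ dν)² ≤ (∫_G s² m_k φ_λ dν)(∫_G m_k φ_λ dν)`. -/
theorem sq_integral_log_mul_le {k lam : ℝ} (hk : 1 < k) (h1 : lam < k) (h2 : 2 < k + lam) :
    (∫ g, Real.log ‖mat g 0 0‖ * ((1 - ‖orbit g‖ ^ 2) ^ (k / 2) * sph lam g) ∂(nu haarCircle)) ^ 2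
      ≤ (∫ g, Real.log ‖mat g 0 0‖ ^ 2 * ((1 - ‖orbit g‖ ^ 2) ^ (k / 2) * sph lam g) ∂(nu haarCircle))
        * ∫ g, (1 - ‖orbit g‖ ^ 2) ^ (k / 2) * sph lam g ∂(nu haarCircle) := by
  have hf : Continuous fun g : SU11 =>
      Real.log ‖mat g 0 0‖ ^ 2 * ((1 - ‖orbit g‖ ^ 2) ^ (k / 2) * sph lam g) :=
    (continuous_log_norm_mat.pow 2).mul ((continuous_orbit_rpow k).mul (continuous_sph lam))
  have hh : Continuous fun g : SU11 => (1 - ‖orbit g‖ ^ 2) ^ (k / 2) * sph lam g :=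
    (continuous_orbit_rpow k).mul (continuous_sph lam)
  have hf0 : ∀ g, 0 ≤ Real.log ‖mat g 0 0‖ ^ 2 * ((1 - ‖orbit g‖ ^ 2) ^ (k / 2) * sph lam g) :=
    fun g => mul_nonneg (sq_nonneg _) (mul_nonneg (orbit_rpow_nonneg k g) (sph_pos lam g).le)
  have hh0 : ∀ g, 0 ≤ (1 - ‖orbit g‖ ^ 2) ^ (k / 2) * sph lam g :=
    fun g => mul_nonneg (orbit_rpow_nonneg k g) (sph_pos lam g).le
  have key := integral_rpow_mul_rpow_le hf hh hf0 hh0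
    (integrable_sq_log_norm_mat_mul_orbit_rpow_mul_sph hk h1 h2)
    (integrable_orbit_rpow_mul_sph hk h1 h2) (a := 1 / 2) (b := 1 / 2) (by norm_num) (by norm_num)
    (by norm_num)
  -- the geometric mean of the two integrands is the first-moment integrand
  have e : ∀ g, (Real.log ‖mat g 0 0‖ ^ 2 * ((1 - ‖orbit g‖ ^ 2) ^ (k / 2) * sph lam g)) ^ (1 / 2 : ℝ)
      * ((1 - ‖orbit g‖ ^ 2) ^ (k / 2) * sph lam g) ^ (1 / 2 : ℝ)
      = Real.log ‖mat g 0 0‖ * ((1 - ‖orbit g‖ ^ 2) ^ (k / 2) * sph lam g) := by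
    intro g
    have hs0 : 0 ≤ Real.log ‖mat g 0 0‖ := log_norm_mat_nonneg g
    rw [Real.mul_rpow (sq_nonneg _) (hh0 g), ← Real.rpow_natCast, ← Real.rpow_mul hs0, mul_assoc,
      ← Real.rpow_add' (hh0 g) (by norm_num)]
    norm_num
  simp_rw [e] at key
  have hI : 0 ≤ ∫ g, Real.log ‖mat g 0 0‖ * ((1 - ‖orbit g‖ ^ 2) ^ (k / 2) * sph lam g) ∂(nu haarCircle) :=
    integral_nonneg fun g => mul_nonneg (log_norm_mat_nonneg g) (hh0 g)
  have hA : 0 ≤ ∫ g, Real.log ‖mat g 0 0‖ ^ 2 * ((1 - ‖orbit g‖ ^ 2) ^ (k / 2) * sph lam g)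
      ∂(nu haarCircle) := integral_nonneg hf0
  have hB : 0 ≤ ∫ g, (1 - ‖orbit g‖ ^ 2) ^ (k / 2) * sph lam g ∂(nu haarCircle) := integral_nonneg hh0
  calc (∫ g, Real.log ‖mat g 0 0‖ * ((1 - ‖orbit g‖ ^ 2) ^ (k / 2) * sph lam g) ∂(nu haarCircle)) ^ 2
      ≤ ((∫ g, Real.log ‖mat g 0 0‖ ^ 2 * ((1 - ‖orbit g‖ ^ 2) ^ (k / 2) * sph lam g) ∂(nu haarCircle))
          ^ (1 / 2 : ℝ) * (∫ g, (1 - ‖orbit g‖ ^ 2) ^ (k / 2) * sph lam g ∂(nu haarCircle))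
          ^ (1 / 2 : ℝ)) ^ 2 := pow_le_pow_left₀ hI key 2
    _ = _ := by
        rw [mul_pow, ← Real.rpow_natCast, ← Real.rpow_natCast, ← Real.rpow_mul hA, ← Real.rpow_mul hB]
        norm_num

/-- **`(d²/dk²) log m̂_k(λ) = ⟨s²⟩ − ⟨s⟩²`**, the variance of the phase `s = log|a|` for the probability
measure `m_k φ_λ dν/m̂_k(λ)`. -/
theorem deriv2_log_jacobi_weight {k lam : ℝ} (hk : 1 < k) (h1 : lam < k) (h2 : 2 < k + lam) :
    deriv (deriv fun k => Real.log (∫ g, (1 - ‖orbit g‖ ^ 2) ^ (k / 2) * sph lam g ∂(nu haarCircle))) k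
      = (∫ g, Real.log ‖mat g 0 0‖ ^ 2 * ((1 - ‖orbit g‖ ^ 2) ^ (k / 2) * sph lam g) ∂(nu haarCircle))
          / (∫ g, (1 - ‖orbit g‖ ^ 2) ^ (k / 2) * sph lam g ∂(nu haarCircle))
        - ((∫ g, Real.log ‖mat g 0 0‖ * ((1 - ‖orbit g‖ ^ 2) ^ (k / 2) * sph lam g) ∂(nu haarCircle))
          / (∫ g, (1 - ‖orbit g‖ ^ 2) ^ (k / 2) * sph lam g ∂(nu haarCircle))) ^ 2 := by
  -- the derivative of `log m̂` is `−M₁/m̂` on the open domain; differentiate the quotient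
  have hM₁ := hasDerivAt_first_moment hk h1 h2
  have hm := hasDerivAt_jacobi_weight hk h1 h2
  have hpos := jacobi_pos hk h1 h2
  have hq := hM₁.neg.div hm hpos.ne'
  have heq : (deriv fun k => Real.log (∫ g, (1 - ‖orbit g‖ ^ 2) ^ (k / 2) * sph lam g
      ∂(nu haarCircle)))
      =ᶠ[𝓝 k] ((-fun k : ℝ => ∫ g, Real.log ‖mat g 0 0‖ * ((1 - ‖orbit g‖ ^ 2) ^ (k / 2) * sph lam g)
        ∂(nu haarCircle)) / fun k : ℝ => ∫ g, (1 - ‖orbit g‖ ^ 2) ^ (k / 2) * sph lam g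
        ∂(nu haarCircle)) := by
    filter_upwards [Ioi_mem_nhds (show max 1 (max lam (2 - lam)) < k by
      rw [max_lt_iff, max_lt_iff]; exact ⟨hk, h1, by linarith⟩)] with k' hk'
    rw [mem_Ioi, max_lt_iff, max_lt_iff] at hk'
    rw [deriv_log_jacobi_weight hk'.1 hk'.2.1 (by linarith [hk'.2.2])]
    simp only [Pi.div_apply, Pi.neg_apply]
  rw [heq.deriv_eq, hq.deriv]
  simp only [Pi.neg_apply]
  field_simp

/-- **The variance is non-negative**: `(d²/dk²) log m̂_k(λ) ≥ 0` — log-convexity in the weight in its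
differential form (cf. `T5SU11JacobiWeight.convexOn_log_jacobi_weight`). -/
theorem deriv2_log_jacobi_weight_nonneg {k lam : ℝ} (hk : 1 < k) (h1 : lam < k) (h2 : 2 < k + lam) :
    0 ≤ deriv (deriv fun k => Real.log (∫ g, (1 - ‖orbit g‖ ^ 2) ^ (k / 2) * sph lam g
      ∂(nu haarCircle))) k := by
  rw [deriv2_log_jacobi_weight hk h1 h2]
  have hpos := jacobi_pos hk h1 h2
  have hcs := sq_integral_log_mul_le hk h1 h2
  rw [div_pow, sub_nonneg, div_le_div_iff₀ (pow_pos hpos 2) hpos]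
  nlinarith [hcs, hpos]

end measure

end Summit.Ventures.HodgeRepro2.T5SU11JacobiWeightDeriv2
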